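import Summits.ABC.IUTFork.Cor312HullDefinedDHVolArch
import Summits.ABC.IUTFork.Cor312ThetaFiniteDHVol
import HarnessLib

/-!
# [IUTchIII] Corollary 3.12, statement — `ThetaFinite` for the real setting with the verbatim volumes AND an
# honest archimedean place (`Real.settingDHVolArch`)

Record-only file (D-0012) of the abc-iut cell (wave-5 prover seat abc-iut-w5-d163 gen 2; TEAM A row A-0 NAMED
LEFTOVER (4) «archimedean radial container vs DH convention», sequel of `Cor312HullDefinedDHVolArch`); TAKES NO SIDE on [IUTchIII] Cor. 3.12. The archimedean twin of abc-iut-c312-5's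
`Cor312ThetaFiniteDHVol` (gen 3): the SAME good-prime computation ([IUTchIV] Thm. 1.10, proof, Step (vi), kurims
`paper:url-56bcb0f95768` p. 29: at a prime `p > 2`, `p ∤ disc(F)`, where the union of the Θ-boxes is the unit
polydisc `𝒪_L`, "the container of possible images is precisely equal to the tensor product of log-shells", of
normalised log-volume `0`), now read at the assembled real setting `Real.settingDHVolArch` of
`Cor312SettingDHVolArch` — c312-7's per-frame assembler over the real log-shells of `F` whose container is c312-5's
VERBATIM one at every prime AND abc-iut-L5-t7's radial/angular log-volume on `M_I` at `∞` — and the resulting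
`ThetaFinite`:

* `logvol_preimage_normalizedPacket_settingDHVolArch` / `preimage_factorMapDHArch_hullSet_one` /
  `thetaHull_settingDHVolArch_eq_of_good` / `thetaLocal_settingDHVolArch_eq_zero` — at a good prime with unit-polydisc
  boxes the hull of the union of ALL possible images is `e⁻¹(Π_{v⃗} I_{v⃗}) = e⁻¹(Π_{v⃗} (R_{v⃗})^∼)` and the local
  Θ-volume is `0` (c312-5's lattice lemmas BY NAME; the prime components of the two settings agree definitionally);
* **`thetaFinite_settingDHVolArch`** — `ThetaFinite` from: bounded and nondegenerate boxes at every `(j ∈ 𝔽_l^⋇, v_ℚ)`,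
  `v_ℚ = ∞` INCLUDED (⇒ every local Θ-volume is a real number, `Cor312HullDefinedDHVolArch`), and unit-polydisc
  boxes off a finite prime set (⇒ the global sum of [IUTchIII] Prop. 3.9 (iii) is a finite sum; the archimedean
  term — `(j+1)·log π` when the boxes exhaust the Step (vii) container, `Cor312ThetaLocalDHVolArch` — is ONE term of it).
[claim: Mochizuki2012, status: disputed] for the quoted sentences; the mathematics is classical.
Deliberately NOT here: the Θ-boxes of the genuine Θ-pilot object (binder), `BridgeHyps` and the Step (vii) form of
the `∞`-conditions (sequel `Cor312BridgeHypsDHVolArch`), any judgement on Cor. 3.12.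
-/

noncomputable section

open Set Function NumberField IsDedekindDomain Bornology
open scoped Pointwise

namespace Summit.ABC

namespace IUTFork

namespace Thm311

namespace Real

open Cor312 Cor312Vol Literature.IUT.LogThetaLattice Literature.IUT.LogVolume Literature.IUT.LogVolume.Prop15iii
  PiTensorProduct


variable {F : Type} [Field F] [NumberField F] (X : PilotData F) {logv : PadicLogs F} (hlog : LogvAnalytic logv)
  (hc : ∀ w : InfinitePlace F, w.IsComplex)

section Setting

variable (M : Type) [Field M] [NumberField M]
  (archPk : ∀ (j : (thetaIndex X).Label) (vQ : (thetaIndex X).VQ), Set ((logShellsDH X logv).Packet j vQ))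
  (archSub : ∀ (j : (thetaIndex X).Label) (v : (thetaIndex X).V),
    Set ((logShellsDH X logv).Packet j ((thetaIndex X).over v)))
  (Ψ : ℤ → ∀ v : (thetaIndex X).V, v ∈ (thetaIndex X).Vbad → Set ((logShellsDH X logv).StarPacket v))
  (act : ℤ → ∀ v : (thetaIndex X).V, v ∈ (thetaIndex X).Vbad →
    (logShellsDH X logv).StarPacket v → Module.End ℚ ((logShellsDH X logv).StarPacket v))
  (Mmod : ℤ → ∀ j : (thetaIndex X).LabelStar, Set ((logShellsDH X logv).GlobalPacket j.1))
  (region : ℤ → ∀ j : (thetaIndex X).LabelStar, FinDivisor M → ∀ vQ : (thetaIndex X).VQ,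
    Set ((logShellsDH X logv).Packet j.1 vQ))
  (n : ℤ) {HT : Type} {LogLink : HT → HT → Type} {IsFull : ∀ {s t : HT}, LogLink s t → Prop}
  (lat : LGPGaussianLogThetaLattice LogLink IsFull)
  {Frd : Type} {IsoF : Frd → Frd → Type} {Ob : Frd → Type} {realify : Frd → Frd} {Strip : Type}
  {IsoS : Strip → Strip → Type} {Mv : ∀ v : (thetaIndex X).V, v ∈ (thetaIndex X).Vbad → Type}
  [∀ v h, Monoid (Mv v h)]
  (sig : GlobalLGPFrobenioidSignature (thetaIndex X).lstar (thetaIndex X).V (· ∈ (thetaIndex X).Vbad)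
    Frd IsoF Ob realify Strip IsoS Mv)
  (split : SplittingMonoids Mv) {ObΔ : Type} {N : ∀ v : (thetaIndex X).V, v ∈ (thetaIndex X).Vbad → Type}
  [∀ v h, Monoid (N v h)] (qData : QPilotData ObΔ N)
  (thetaBox : ℤ → Ob sig.Clgp → ∀ (j : (thetaIndex X).Label) (vQ : (thetaIndex X).VQ),
    Set (∀ s : factorIdxDHArch X hlog j vQ, factorFieldDHArch X hlog j vQ s))
  (qCentre : ObΔ → ∀ (j : (thetaIndex X).Label) (vQ : (thetaIndex X).VQ),
    ∀ s : factorIdxDHArch X hlog j vQ, factorFieldDHArch X hlog j vQ s)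
  (hq : ∀ j vQ s, qCentre (qPilotObject qData) j vQ s ≠ 0)
  (hfin : ∀ j : (thetaIndex X).Label, (Function.support fun vQ =>
    ((situationDHVolArch X hlog hc M archPk archSub Ψ act Mmod region).D n).logvol j vQ
      (factorMapDHArch X hlog hc j vQ ⁻¹' hullSet (factorFieldDHArch X hlog j vQ)
        (qCentre (qPilotObject qData) j vQ))).Finite)

/-! ## 1. Good primes: the prime components of `settingDHVolArch` are c312-5's, so its computation transplants -/

/-- The log-volume of `e⁻¹(Π_{v⃗} (R_{v⃗})^∼)` in the container VANISHES at every prime (normalisation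
`log μ̄((R)^∼) = 0`, Dupuy–Hilado (3.6)); archimedean-honest setting. [cite: DupuyHilado2025, Def. 3.6.1] -/
theorem logvol_preimage_normalizedPacket_settingDHVolArch (j : (thetaIndex X).Label) (pp : Nat.Primes) :
    haveI : Fact (pp : ℕ).Prime := ⟨pp.2⟩
    ((situationDHVolArch X hlog hc M archPk archSub Ψ act Mmod region).D n).logvol j (.inr pp)
      ((presAt X hlog pp).comparison j ⁻¹' Set.pi univ fun e =>
        (normalizedPacket (pp : ℕ) ((presAt X hlog pp).kk e) : Set ((presAt X hlog pp).X e))) = 0 := by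
  haveI : Fact (pp : ℕ).Prime := ⟨pp.2⟩
  haveI : Nonempty ((thetaIndex X).Caps j) := ⟨0⟩
  refine ((realizes_situationDHVolArch X hlog hc M archPk archSub Ψ act Mmod region n).logvol_eq j (.inr pp)
    _).trans ?_
  have h := SummandPieces.logvol_preimage_pi (summandPiecesDHArch X hlog hc) j (.inr pp)
    (R := fun e => (normalizedPacket (pp : ℕ) ((presAt X hlog pp).kk e) : Set ((presAt X hlog pp).X e)))
    (fun e => (presAt X hlog pp).packetAdm_normalizedPacket_kk e)
  refine h.trans (Finset.sum_eq_zero fun e _ => ?_)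
  show (summandPiecesDHArch X hlog hc).w j (.inr pp) e *
    packetLogμ (pp : ℕ) ((presAt X hlog pp).kk e) (normalizedPacket (pp : ℕ) ((presAt X hlog pp).kk e)) = 0
  rw [packetLogμ_normalizedPacket, mul_zero]

/-- … and `e⁻¹(Π_{v⃗} (R_{v⃗})^∼)` is ADMISSIBLE there. [cite: DupuyHilado2025, Def. 3.6.1] -/
theorem adm_preimage_normalizedPacket_settingDHVolArch (j : (thetaIndex X).Label) (pp : Nat.Primes) :
    haveI : Fact (pp : ℕ).Prime := ⟨pp.2⟩
    ((situationDHVolArch X hlog hc M archPk archSub Ψ act Mmod region).D n).Adm j (.inr pp)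
      ((presAt X hlog pp).comparison j ⁻¹' Set.pi univ fun e =>
        (normalizedPacket (pp : ℕ) ((presAt X hlog pp).kk e) : Set ((presAt X hlog pp).X e))) := by
  haveI : Fact (pp : ℕ).Prime := ⟨pp.2⟩
  exact ⟨_, Set.image_preimage_eq _ ((presAt X hlog pp).comparison_surjective j),
    fun e => (presAt X hlog pp).packetAdm_normalizedPacket_kk e⟩

/-- The preimage under the field-factor comparison of the unit polydisc `𝒪_L = hullSet 1` IS
`e⁻¹(Π_{v⃗} (R_{v⃗})^∼)` at EVERY prime — c312-5's `preimage_factorMapDH_hullSet_one`, the prime components of the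
two field-factor comparisons being definitionally equal. [cite: Mochizuki2012, IUTchIV Prop. 1.4 (i) p. 13] -/
theorem preimage_factorMapDHArch_hullSet_one (j : (thetaIndex X).Label) (pp : Nat.Primes) :
    haveI : Fact (pp : ℕ).Prime := ⟨pp.2⟩
    factorMapDHArch X hlog hc j (.inr pp) ⁻¹' hullSet (factorFieldDHArch X hlog j (.inr pp)) (fun _ => 1) =
      (presAt X hlog pp).comparison j ⁻¹' Set.pi univ fun e =>
        (normalizedPacket (pp : ℕ) ((presAt X hlog pp).kk e) : Set ((presAt X hlog pp).X e)) :=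
  preimage_factorMapDH_hullSet_one X hlog j pp

/-- **At a GOOD prime the hull of the union of ALL possible images IS `e⁻¹(Π_{v⃗} I_{v⃗})`** (archimedean-honest
setting): for `p > 2`, `p ∤ disc(F)`, `j ∈ 𝔽_l^⋇` and unit-polydisc boxes at `(j, p)`,
`^{n,∘}𝒰_{j,p} = e⁻¹(Π_{v⃗} I_{v⃗})` ([IUTchIV] Thm. 1.10 Step (vi)). Proof transplanted from c312-5's
`thetaHull_settingDHVol_eq_of_good`. [cite: Mochizuki2012, IUTchIV Thm 1.10 proof Step (vi) p. 29] -/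
theorem thetaHull_settingDHVolArch_eq_of_good (i : Fin (thetaIndex X).lstar) (pp : Nat.Primes)
    (hp2 : 2 < (pp : ℕ)) (hdisc : ¬ ((pp : ℕ) : ℤ) ∣ NumberField.discr F)
    (hbox : (⋃ m : ℤ, thetaBox m (thetaPilotObject sig split) (Setting.labelSucc i) (.inr pp)) =
      hullSet (factorFieldDHArch X hlog (Setting.labelSucc i) (.inr pp)) (fun _ => 1)) :
    haveI : Fact (pp : ℕ).Prime := ⟨pp.2⟩
    (settingDHVolArch X hlog hc M archPk archSub Ψ act Mmod region n lat sig split qData thetaBox qCentre hq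
        hfin).thetaHull (Setting.labelSucc i) (.inr pp) =
      (presAt X hlog pp).latticePk (Setting.labelSucc i) 1 := by
  haveI : Fact (pp : ℕ).Prime := ⟨pp.2⟩
  have hj := two_le_card_caps_labelSucc X i
  have he := absRamificationIdx_presAt_eq_one X hlog pp hdisc
  -- the lattice `Π I_v⃗` IS `𝒪_L` here
  have hΛ : (presAt X hlog pp).latticeF (Setting.labelSucc i) 1 =
      hullSet (factorFieldDHArch X hlog (Setting.labelSucc i) (.inr pp)) (fun _ => 1) :=
    (presAt X hlog pp).latticeF_one_eq_hullSet_of_unramified hp2 hj he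
  have hHul : IsHullSet (factorFieldDHArch X hlog (Setting.labelSucc i) (.inr pp))
      (hullSet (factorFieldDHArch X hlog (Setting.labelSucc i) (.inr pp)) (fun _ => 1)) :=
    ⟨fun _ => 1, fun _ => one_ne_zero, rfl⟩
  -- the (Ind3)-region is `e⁻¹(𝒪_L) = latticePk 1`
  have h3 : (settingDHVolArch X hlog hc M archPk archSub Ψ act Mmod region n lat sig split qData thetaBox qCentre hq
      hfin).thetaRegion3 (Setting.labelSucc i) (.inr pp) = (presAt X hlog pp).latticePk (Setting.labelSucc i) 1 := by
    rw [thetaRegion3_settingDHVolArch, hbox]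
    exact (preimage_factorMapDHArch_hullSet_one X hlog hc _ pp).trans
      ((presAt X hlog pp).latticePk_one_eq_of_unramified hp2 hj he).symm
  -- the union of the possible images has image `𝒪_L`
  have hU : factorMapDHArch X hlog hc (Setting.labelSucc i) (.inr pp) ''
      ⋃₀ (settingDHVolArch X hlog hc M archPk archSub Ψ act Mmod region n lat sig split qData thetaBox qCentre hq
        hfin).possibleImages (Setting.labelSucc i) (.inr pp) =
      hullSet (factorFieldDHArch X hlog (Setting.labelSucc i) (.inr pp)) (fun _ => 1) := by
    apply Set.Subset.antisymm
    · have hsub : ⋃₀ (settingDHVolArch X hlog hc M archPk archSub Ψ act Mmod region n lat sig split qData thetaBox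
          qCentre hq hfin).possibleImages (Setting.labelSucc i) (.inr pp) ⊆
          (presAt X hlog pp).latticePk (Setting.labelSucc i) 1 :=
        (settingDHVolArch X hlog hc M archPk archSub Ψ act Mmod region n lat sig split qData thetaBox qCentre hq
          hfin).sUnion_possibleImages_subset (fun Φ hΦ => (presAt X hlog pp).family_image_latticePk hΦ _ 1) h3.le
      rintro _ ⟨x, hx, rfl⟩
      rw [← hΛ]
      exact ⟨(presAt X hlog pp).comparison _ x, hsub hx, rfl⟩
    · rw [← hbox, ← image_thetaRegion3_settingDHVolArch X hlog hc M archPk archSub Ψ act Mmod region n lat sig split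
        qData thetaBox qCentre hq hfin _ (.inr pp)]
      exact Set.image_mono ((settingDHVolArch X hlog hc M archPk archSub Ψ act Mmod region n lat sig split qData
        thetaBox qCentre hq hfin).thetaRegion3_subset_sUnion _ _)
  have hb : IsBounded (factorMapDHArch X hlog hc (Setting.labelSucc i) (.inr pp) ''
      ⋃₀ (settingDHVolArch X hlog hc M archPk archSub Ψ act Mmod region n lat sig split qData thetaBox qCentre hq
        hfin).possibleImages (Setting.labelSucc i) (.inr pp)) := by
    rw [hU]
    exact isBounded_hullSet _ _
  -- compute the hull through c312-7's pulled-back real frame (the `p`-component of `realFramesDHArch`)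
  show ((HullFrame.ofLocalFields (factorFieldDHArch X hlog (Setting.labelSucc i) (.inr pp))).comap
      (factorMapDHArch X hlog hc (Setting.labelSucc i) (.inr pp))).hull
      (⋃₀ (settingDHVolArch X hlog hc M archPk archSub Ψ act Mmod region n lat sig split qData thetaBox qCentre hq
        hfin).possibleImages (Setting.labelSucc i) (.inr pp)) = _
  rw [HullFrame.comap_hull _ _ hb, hU,
    HullFrame.ofLocalFields_hull_eq _ (isBounded_hullSet _ _) hHul.isNondegenerate, holomorphicHull_hullSet]
  exact (preimage_factorMapDHArch_hullSet_one X hlog hc _ pp).trans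
    ((presAt X hlog pp).latticePk_one_eq_of_unramified hp2 hj he).symm

/-- **At a GOOD prime the local Θ-volume is `0`** (archimedean-honest setting).
[cite: Mochizuki2012, IUTchIV Thm 1.10 proof Step (vi) p. 29] -/
theorem thetaLocal_settingDHVolArch_eq_zero (i : Fin (thetaIndex X).lstar) (pp : Nat.Primes)
    (hp2 : 2 < (pp : ℕ)) (hdisc : ¬ ((pp : ℕ) : ℤ) ∣ NumberField.discr F)
    (hbox : (⋃ m : ℤ, thetaBox m (thetaPilotObject sig split) (Setting.labelSucc i) (.inr pp)) =
      hullSet (factorFieldDHArch X hlog (Setting.labelSucc i) (.inr pp)) (fun _ => 1)) :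
    (settingDHVolArch X hlog hc M archPk archSub Ψ act Mmod region n lat sig split qData thetaBox qCentre hq
        hfin).thetaLocal (Setting.labelSucc i) (.inr pp) = ((0 : ℝ) : WithTop ℝ) := by
  haveI : Fact (pp : ℕ).Prime := ⟨pp.2⟩
  have hHul : IsHullSet (factorFieldDHArch X hlog (Setting.labelSucc i) (.inr pp))
      (hullSet (factorFieldDHArch X hlog (Setting.labelSucc i) (.inr pp)) (fun _ => 1)) :=
    ⟨fun _ => 1, fun _ => one_ne_zero, rfl⟩
  have hHD : (settingDHVolArch X hlog hc M archPk archSub Ψ act Mmod region n lat sig split qData thetaBox qCentre hq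
      hfin).HullDefined (Setting.labelSucc i) (.inr pp) :=
    hullDefined_settingDHVolArch_inr X hlog hc M archPk archSub Ψ act Mmod region n lat sig split qData thetaBox
      qCentre hq hfin _ pp (by rw [hbox]; exact isBounded_hullSet _ _) (by rw [hbox]; exact hHul.isNondegenerate)
  unfold Setting.thetaLocal
  rw [if_pos hHD, thetaHull_settingDHVolArch_eq_of_good X hlog hc M archPk archSub Ψ act Mmod region n lat sig split
      qData thetaBox qCentre hq hfin i pp hp2 hdisc hbox,
    (presAt X hlog pp).latticePk_one_eq_of_unramified hp2 (two_le_card_caps_labelSucc X i)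
      (absRamificationIdx_presAt_eq_one X hlog pp hdisc)]
  exact congrArg _ (logvol_preimage_normalizedPacket_settingDHVolArch X hlog hc M archPk archSub Ψ act Mmod region
    n (Setting.labelSucc i) pp)

/-! ## 2. `ThetaFinite` -/

/-- **`ThetaFinite` for the real setting with the verbatim volumes and an honest archimedean place, from three
Θ-box conditions**: bounded and nondegenerate boxes at every `(j ∈ 𝔽_l^⋇, v_ℚ)`, `v_ℚ = ∞` INCLUDED (⇒ every local
Θ-volume is a real number), and unit-polydisc boxes off a finite prime set (⇒ zero local Θ-volume at every
further prime not dividing `2·disc(F)`; `∞` is one place). [claim: Mochizuki2012, status: disputed] -/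
theorem thetaFinite_settingDHVolArch
    (hbdd : ∀ (i : Fin (thetaIndex X).lstar) (vQ : (thetaIndex X).VQ),
      IsBounded (⋃ m : ℤ, thetaBox m (thetaPilotObject sig split) (Setting.labelSucc i) vQ))
    (hnd : ∀ (i : Fin (thetaIndex X).lstar) (vQ : (thetaIndex X).VQ),
      IsNondegenerate (factorFieldDHArch X hlog (Setting.labelSucc i) vQ)
        (⋃ m : ℤ, thetaBox m (thetaPilotObject sig split) (Setting.labelSucc i) vQ))
    (hcof : ∀ i : Fin (thetaIndex X).lstar, {pp : Nat.Primes |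
      (⋃ m : ℤ, thetaBox m (thetaPilotObject sig split) (Setting.labelSucc i) (.inr pp)) ≠
        hullSet (factorFieldDHArch X hlog (Setting.labelSucc i) (.inr pp)) (fun _ => 1)}.Finite) :
    (settingDHVolArch X hlog hc M archPk archSub Ψ act Mmod region n lat sig split qData thetaBox qCentre hq
      hfin).ThetaFinite := by
  refine ⟨fun i vQ => thetaLocal_ne_top_settingDHVolArch X hlog hc M archPk archSub Ψ act Mmod region n lat sig
      split qData thetaBox qCentre hq hfin (Setting.labelSucc i) (hbdd i) (hnd i) vQ, fun i => ?_⟩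
  have hD : 2 * (NumberField.discr F).natAbs ≠ 0 :=
    mul_ne_zero two_ne_zero (Int.natAbs_ne_zero.2 (NumberField.discr_ne_zero F))
  refine ((Set.finite_range Sum.inl).union (((finite_primes_dvd hD).union (hcof i)).image Sum.inr)).subset ?_
  intro vQ hvQ
  rcases vQ with u | pp
  · exact Or.inl ⟨u, rfl⟩
  · refine Or.inr ⟨pp, ?_, rfl⟩
    by_contra hpp
    simp only [Set.mem_union, Set.mem_setOf_eq, not_or, ne_eq, not_not] at hpp
    obtain ⟨hp2, hdisc⟩ := good_of_not_dvd (F := F) pp hpp.1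
    have h0 : ((settingDHVolArch X hlog hc M archPk archSub Ψ act Mmod region n lat sig split qData thetaBox qCentre
        hq hfin).thetaLocal (Setting.labelSucc i) (.inr pp)).untopD 0 = 0 := by
      rw [thetaLocal_settingDHVolArch_eq_zero X hlog hc M archPk archSub Ψ act Mmod region n lat sig split qData
        thetaBox qCentre hq hfin i pp hp2 hdisc hpp.2, WithTop.untopD_coe]
    exact absurd h0 hvQ

end Setting

end Real

end Thm311

end IUTFork

end Summit.ABC

end
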